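import Summits.KontsevichZagierPeriods.KontsevichZagierPeriods.Theses.CommonUnfolding
import Literature.NumberTheory.Transcendental.KZUnfolding

/-!
# `PeakNormalForm` (stmt-KontsevichZagierPeriods-4828, route CommonUnfolding, crux rank 2) — line `zero-shadows`

Strategist's ALTERNATIVE line (registered next to `Lines/birth.lean`, which it does not touch).

Crux (route file, verbatim up to its `let`s = `KZ.levelRel`, `KZ.Round`): **single-peak normal form** —
KZ-equivalent integral representations `r` (dim `n`), `r'` (dim `m`) have a COMMON UNFOLDING
(`KZ.CommonUnfolding r r'`: one peak `R`, two chains of descent rounds from `[R]` ending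
level-equivalent to `[r]`, resp. `[r']`).

## The line: LINEARISE, do not complete diamonds

`KZ.relations` is an ABELIAN group.  After LEVELLING a derivation of `[r] − [r']` to one level
`N = d + 1` (cylinder towers `R = r × [0,1]^{N−n} ⟶* r`, `R' ⟶* r'`), the difference
`[R] − [R']` is a `ℤ`-combination of level-`N` generator instances: level moves, change-of-variables
instances between dimension-`N` representations, and LEVELLED Newton–Leibniz instances
`[B] − [S]` (`B` a band over `b`, `S = b × [0,1]` the cylinder over the same base).  Instead of
unfolding generators one at a time IN CONTEXT and composing by a diamond (birth's XL
`stub_diamond`), this line shows that every generator lies in ONE SUBGROUP and lets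
`AddSubgroup.closure_le` do the composition:

* `H_N` = the **zero-shadows landing at level `N`**: formal sums `x` for which there is a
  LEVELLED chain `z h ⟶ z (h−1) ⟶ ⋯ ⟶ z 0` of descent rounds (round `j+1 ↦ j` has its bands in
  dimension `N + j + 1`, its bases in dimension `N + j`), starting at a LEVEL-NULL sum
  `z h ∈ levelRel` and ending at `z 0 ≡ x (mod levelRel)`.  ("`x` is, up to level moves, the
  lockstep shadow of zero.")
* `stub_shadowSubgroup` (M): `H_N` is a subgroup — `0` (height `0`); `−` (negate every band and
  base: `[B.neg] − [b.neg]` is again a Newton–Leibniz instance, signs live in the integrand by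
  `KZ.of_add_of_neg_mem_levelRel`); `+` (pad the shorter chain at the TOP with literal zeros —
  a round out of a level-null node is a round out of `0` — then add the two chains levelwise,
  concatenating band families `Fin.append`; lockstep is automatic because chains are LEVELLED).
  This replaces transitivity/confluence: linearity instead of the diamond.
* `stub_bandShadow` (M, HEIGHT ONE): a levelled Newton–Leibniz instance `g = [B] − [S]` is a
  zero-shadow of height `1`: `z 1 := [B × I] − [swap (B × I)] ∈ permRel` (swap of the last two
  coordinates, `KZ.of_sub_of_reindex_mem_permRel`), ONE round with the two bands
  `B × I ⟶ B` (peel the cylinder coordinate, primitive `u · ∂ₜF`) and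
  `(swap (B × I)).neg ⟶ S.neg` (it is a band over `S = b × I` with `B`'s own primitive `−F(x,t)`),
  landing at `z 0 := [B] + [S.neg] ≡ g`.  Level moves themselves are height-`0` shadows (glue).
* `stub_transportShadow` (L; the content of crux `TransportElimination`, stmt-4829, in LEVELLED
  form): every change-of-variables instance between dimension-`(d+1)` representations is a
  zero-shadow of some height.  (Any constructive proof of stmt-4829 — primitive-map factorisation
  on cells, one-coordinate substitutions at height 1 — yields levelled chains; and by the
  subgroup property heights do NOT add up under composition of substitutions.)
* `stub_levelling` (M): the levelling itself (cylinders of move instances are move instances of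
  the same kind: `KZProductIdeal.of_mul_mem_relations_*` with the unit interval on the left, one
  block flip `reindex` to put the cylinder coordinate last; towers peel one coordinate per round).
* `stub_cylinderPeak` (M): a zero-shadow chain for `[R'] − [R]` gives the common unfolding with
  peak the CYLINDER `R × [0,1]^h`: left descent = `h` peels; right descent = the lockstep chain
  `[R × I^{j+1}] + z (j+1) ⟶ [R × I^j] + z j` (bands: the peel band and the bands of `z`'s round),
  ending at `[R] + z 0 ≡ [R']`.

Composition (sorry-free, below): level (`stub_levelling`), `closure (gens d) ≤ H_{d+1}`
(`levelRel ⊆ H` at height `0`; `covGens ⊆ H` by `stub_transportShadow`; `cylBandGens ⊆ H` by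
`stub_bandShadow`), hence `[R'] − [R] ∈ H_{d+1}`, hence a zero-shadow chain, hence
`CUF [R] [R']` (`stub_cylinderPeak`), hence — descending the two cylinder towers, rounds absorbing
level moves on the left — `KZ.CommonUnfolding r r'`, which is the crux on the nose.

Consequences recorded in `Lines/zero-shadows.md`: no diamond, no interchange lemma (crux 4 is off
the path of this crux); `PeakNormalForm ⟺ TransportElimination` (levelled) modulo the M-sized
stubs, and `PeakNormalForm → TransportElimination` outright (a change-of-variables pair is
KZ-equivalent).  Disproof used: none on file (no `Disproof.lean` for this crux).  Dead lines: none.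
-/

namespace Summit.KontsevichZagierPeriods.KontsevichZagierPeriods.Cruxes.PeakNormalForm.ZeroShadows

open Literature.NumberTheory.Transcendental
open Literature.NumberTheory.Transcendental.KZ
open Summit.KontsevichZagierPeriods.KontsevichZagierPeriods.Theses.CommonUnfolding (PeakNormalForm)

/-! ## Notions of the line (sorry-free definitions; the stubs inline them over tree declarations) -/

/-- A LEVELLED descent round: `KZ.Round` with the base dimension `d` exposed (bands in dimension
`d + 1`, bases in dimension `d`).  `KZ.Round C c ↔ ∃ d, LRound d C c` definitionally. -/
def LRound (d : ℕ) (C c : FormalRep) : Prop :=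
  ∃ (k : ℕ) (B : Fin k → IntegralRep (d + 1)) (b : Fin k → IntegralRep d),
    (∀ i, of (B i) - of (b i) ∈ newtonLeibnizRel) ∧ C - ∑ i, of (B i) ∈ levelRel ∧
    c = ∑ i, of (b i)

/-- **Zero-shadow of height `h` landing at level `N`**: a levelled chain `z h ⟶ ⋯ ⟶ z 0`
(round `z (j+1) ⟶ z j` at base level `N + j`) from a LEVEL-NULL top `z h ∈ levelRel` to
`z 0 ≡ x (mod levelRel)`. -/
def ZeroShadow (N h : ℕ) (x : FormalRep) : Prop :=
  ∃ z : ℕ → FormalRep, z 0 - x ∈ levelRel ∧ z h ∈ levelRel ∧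
    ∀ j < h, LRound (N + j) (z (j + 1)) (z j)

/-- The zero-shadows landing at level `N` (all heights). -/
def shadows (N : ℕ) : Set FormalRep := {x | ∃ h, ZeroShadow N h x}

/-- `S` is the cylinder `b × [0,1]` over `b` (last coordinate the cylinder coordinate). -/
def IsCylOver {d : ℕ} (b : IntegralRep d) (S : IntegralRep (d + 1)) : Prop :=
  S.domain = {z | (Fin.init z : Fin d → ℝ) ∈ b.domain ∧ 0 ≤ z (Fin.last d) ∧ z (Fin.last d) ≤ 1} ∧
    ∀ z ∈ S.domain, S.integrand z = b.integrand (Fin.init z)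

/-- LEVELLED Newton–Leibniz instances with bands in dimension `d + 1`: `[B] − [S]`, `B` a band over
`b` (`[B] − [b] ∈ newtonLeibnizRel`), `S` the cylinder over the same base `b`. -/
def cylBandGens (d : ℕ) : Set FormalRep :=
  {c | ∃ (B S : IntegralRep (d + 1)) (b : IntegralRep d),
    of B - of b ∈ newtonLeibnizRel ∧ IsCylOver b S ∧ c = of B - of S}

/-- Change-of-variables instances (rule 2) between representations of dimension `N` (the set
`KZ.changeOfVariablesRel` with its dimension fixed to `N`). -/
def covGens (N : ℕ) : Set FormalRep :=
  {c | ∃ (s s' : IntegralRep N) (Φ : (Fin N → ℝ) → (Fin N → ℝ))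
      (Φ' : (Fin N → ℝ) → (Fin N → ℝ) →L[ℝ] (Fin N → ℝ)),
    IsSemialgebraicMapOn ℚ s.domain Φ ∧ (∀ x ∈ s.domain, HasFDerivWithinAt Φ (Φ' x) s.domain x) ∧
    Set.InjOn Φ s.domain ∧ s'.domain = Φ '' s.domain ∧
    (∀ x ∈ s.domain, s.integrand x = s'.integrand (Φ x) * |(Φ' x).det|) ∧ c = of s - of s'}

/-- Level-`(d+1)` generator instances after levelling: level moves (any dimension — they are
height-`0` shadows at every level), change of variables in dimension `d + 1`, levelled
Newton–Leibniz with bands in dimension `d + 1`. -/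
def gens (d : ℕ) : Set FormalRep :=
  (levelRel : Set FormalRep) ∪ covGens (d + 1) ∪ cylBandGens d

/-- Common unfolding of two FORMAL SUMS (as in `Lines/birth.lean`): one peak `R`, two chains of
rounds from `[R]`, ending level-equivalent to `x`, resp. `y`.  On generators `x = [r]`, `y = [r']`
it is `KZ.CommonUnfolding r r'` on the nose. -/
def CUF (x y : FormalRep) : Prop :=
  ∃ (M : ℕ) (R : IntegralRep M) (c c' : FormalRep),
    Relation.ReflTransGen Round (of R) c ∧ Relation.ReflTransGen Round (of R) c' ∧
    c - x ∈ levelRel ∧ c' - y ∈ levelRel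

/-! ## The registered stubs (statements spelled out over tree declarations) -/

/-- **Stub 1 — LEVELLING.**  KZ-equivalent representations have cylinder towers `R ⟶* r`,
`R' ⟶* r'` from a common level `d + 1` whose tops differ by an element of the subgroup generated
by level moves, change-of-variables instances between dimension-`(d+1)` representations, and
levelled Newton–Leibniz instances `[B] − [b × [0,1]]` with bands `B` in dimension `d + 1`.
(Push a finite derivation through the homomorphism `[s] ↦ [u]^{N − dim s} * [s]`, `u = [[0,1], 1]`:
`KZProductIdeal.of_mul_mem_relations_of_mem_*` sends each move to a move of the same kind; one
`reindex` flip puts the cylinder coordinate last; `N` may always be increased, so `N = d + 1`.)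
[size M] -/
theorem stub_levelling : ∀ ⦃n m : ℕ⦄ (r : KZ.IntegralRep n) (r' : KZ.IntegralRep m), KZ.Equivalent r r' → ∃ (d : ℕ) (R R' : KZ.IntegralRep (d + 1)), Relation.ReflTransGen KZ.Round (KZ.of R) (KZ.of r) ∧ Relation.ReflTransGen KZ.Round (KZ.of R') (KZ.of r') ∧ KZ.of R - KZ.of R' ∈ AddSubgroup.closure ((↑KZ.levelRel : Set KZ.FormalRep) ∪ {c : KZ.FormalRep | ∃ (s s' : KZ.IntegralRep (d + 1)) (Φ : (Fin (d + 1) → ℝ) → (Fin (d + 1) → ℝ)) (Φ' : (Fin (d + 1) → ℝ) → (Fin (d + 1) → ℝ) →L[ℝ] (Fin (d + 1) → ℝ)), IsSemialgebraicMapOn ℚ s.domain Φ ∧ (∀ x ∈ s.domain, HasFDerivWithinAt Φ (Φ' x) s.domain x) ∧ Set.InjOn Φ s.domain ∧ s'.domain = Φ '' s.domain ∧ (∀ x ∈ s.domain, s.integrand x = s'.integrand (Φ x) * |(Φ' x).det|) ∧ c = KZ.of s - KZ.of s'} ∪ {c : KZ.FormalRep | ∃ (B S : KZ.IntegralRep (d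 + 1)) (b : KZ.IntegralRep d), KZ.of B - KZ.of b ∈ KZ.newtonLeibnizRel ∧ (S.domain = {z | (Fin.init z : Fin d → ℝ) ∈ b.domain ∧ 0 ≤ z (Fin.last d) ∧ z (Fin.last d) ≤ 1} ∧ ∀ z ∈ S.domain, S.integrand z = b.integrand (Fin.init z)) ∧ c = KZ.of B - KZ.of S}) := by
  sorry

/-- **Stub 2 — ZERO-SHADOWS FORM A SUBGROUP** (the engine replacing the diamond: linearity).
For every level `N`, the formal sums that are, modulo level moves, the endpoint of a LEVELLED chain
of descent rounds (round `j+1 ↦ j` with bands in dimension `N + j + 1`) out of a level-null sum,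
form an additive subgroup of `KZ.FormalRep`.  (`0`: height `0`.  `−x`: negate every band and base,
`[B.neg] − [b.neg] ∈ newtonLeibnizRel` with primitive `−F`, and `∑ [b.neg] ≡ −∑ [b]` by
`KZ.of_add_of_neg_mem_levelRel`.  `x + y`: pad the shorter chain at the top by literal zeros — its
old top is level-null, and a round out of a level-null node is a round out of `0` — then add the
chains levelwise, concatenating the band families (`Fin.append`, `Fin.sum_univ_add`).) [size M] -/
theorem stub_shadowSubgroup : ∀ N : ℕ, ∃ H : AddSubgroup KZ.FormalRep, ∀ x : KZ.FormalRep, x ∈ H ↔ ∃ (h : ℕ) (z : ℕ → KZ.FormalRep), z 0 - x ∈ KZ.levelRel ∧ z h ∈ KZ.levelRel ∧ ∀ j < h, ∃ (k : ℕ) (B : Fin k → KZ.IntegralRep (N + j + 1)) (b : Fin k → KZ.IntegralRep (N + j)), (∀ i, KZ.of (B i) - KZ.of (b i) ∈ KZ.newtonLeibnizRel) ∧ z (j + 1) - ∑ i, KZ.of (B i) ∈ KZ.levelRel ∧ z j = ∑ i, KZ.of (b i) := by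
  sorry

/-- **Stub 3 — A LEVELLED NEWTON–LEIBNIZ INSTANCE IS A ZERO-SHADOW OF HEIGHT ONE.**  If `B` is a
band over `b` (`[B] − [b] ∈ newtonLeibnizRel`, primitive `F`) and `S = b × [0,1]` is the cylinder
over the same base, then `[B] − [S]` is, modulo level moves, the one-round lockstep shadow of the
level-null sum `z 1 := [B × I] − [swap (B × I)]` (a `permRel` pair,
`KZ.of_sub_of_reindex_mem_permRel`): the round has the two bands `B × I ⟶ B` (peel the cylinder
coordinate, primitive `u · B.integrand`) and `(swap (B × I)).neg ⟶ S.neg` (a band over `b × I` with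
primitive `−F(x, t)`), and lands at `z 0 := [B] + [S.neg] ≡ [B] − [S]`.  Cylinders:
`IntegralRep.prod` with `[[0,1], 1]` (`KZProduct.lean`). [size M] -/
theorem stub_bandShadow : ∀ (d : ℕ) (B S : KZ.IntegralRep (d + 1)) (b : KZ.IntegralRep d), KZ.of B - KZ.of b ∈ KZ.newtonLeibnizRel → S.domain = {z | (Fin.init z : Fin d → ℝ) ∈ b.domain ∧ 0 ≤ z (Fin.last d) ∧ z (Fin.last d) ≤ 1} → (∀ z ∈ S.domain, S.integrand z = b.integrand (Fin.init z)) → ∃ z : ℕ → KZ.FormalRep, z 0 - (KZ.of B - KZ.of S) ∈ KZ.levelRel ∧ z 1 ∈ KZ.levelRel ∧ ∀ j < 1, ∃ (k : ℕ) (B' : Fin k → KZ.IntegralRep (d + 1 + j + 1)) (b' : Fin k → KZ.IntegralRep (d + 1 + j)), (∀ i, KZ.of (B' i) - KZ.of (b' i) ∈ KZ.newtonLeibnizRel) ∧ z (j + 1) - ∑ i, KZ.of (B' i) ∈ KZ.levelRel ∧ z j = ∑ i, KZ.of (b' i) := by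
  sorry

/-- **Stub 4 — TRANSPORT IS A ZERO-SHADOW** (the content of crux `TransportElimination`,
stmt-KontsevichZagierPeriods-4829, in levelled form; the hardest stub).  For every
change-of-variables instance between representations `s`, `s'` of dimension `d + 1`
(`Φ` `ℚ`-semialgebraic on `σ = s.domain`, differentiable within `σ`, injective on `σ`,
`s'.domain = Φ '' σ`, `f = f' ∘ Φ · |det Φ'|` on `σ`), the difference `[s] − [s']` is, modulo level
moves, the lockstep shadow of a level-null sum along a levelled chain of some height `h`.
(Route plan for stmt-4829: null / `{det Φ' = 0}` parts are junk; on finitely many open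
semialgebraic `C¹` cells `Φ` factors into one-coordinate substitutions and flips; a one-coordinate
substitution `u = φ(x,t)` is a height-`1` shadow via the peak `∂ᵤf′(x,u) · ∂ₜφ(x,t)` between an
anchor `u₀(x)` and `φ(x,t)`; by Stub 2 the heights of the factors need not be added.) [size L] -/
theorem stub_transportShadow : ∀ (d : ℕ) (s s' : KZ.IntegralRep (d + 1)) (Φ : (Fin (d + 1) → ℝ) → (Fin (d + 1) → ℝ)) (Φ' : (Fin (d + 1) → ℝ) → (Fin (d + 1) → ℝ) →L[ℝ] (Fin (d + 1) → ℝ)), IsSemialgebraicMapOn ℚ s.domain Φ → (∀ x ∈ s.domain, HasFDerivWithinAt Φ (Φ' x) s.domain x) → Set.InjOn Φ s.domain → s'.domain = Φ '' s.domain → (∀ x ∈ s.domain, s.integrand x = s'.integrand (Φ x) * |(Φ' x).det|) → ∃ (h : ℕ) (z : ℕ → KZ.FormalRep), z 0 - (KZ.of s - KZ.of s') ∈ KZ.levelRel ∧ z h ∈ KZ.levelRel ∧ ∀ j < h, ∃ (k : ℕ) (B : Fin k → KZ.IntegralRep (d + 1 + j + 1)) (b : Fin k → KZ.IntegralRep (d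 + 1 + j)), (∀ i, KZ.of (B i) - KZ.of (b i) ∈ KZ.newtonLeibnizRel) ∧ z (j + 1) - ∑ i, KZ.of (B i) ∈ KZ.levelRel ∧ z j = ∑ i, KZ.of (b i) := by
  sorry

/-- **Stub 5 — THE CYLINDER PEAK.**  A levelled zero-shadow chain `z` for `[R'] − [R]`
(`R`, `R'` of dimension `d + 1`; `z h` level-null, round `z (j+1) ⟶ z j` with bands in dimension
`d + 1 + j + 1`, `z 0 ≡ [R'] − [R]`) yields a common unfolding of `[R]` and `[R']`: peak
`P := R × [0,1]^h`; left descent the `h` peels `R × I^{j+1} ⟶ R × I^j` (one band each, primitive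
`u · f`); right descent the lockstep chain `[R × I^{j+1}] + z (j+1) ⟶ [R × I^j] + z j` (band family:
the peel band followed by the bands of `z`'s round; the first node `[P] + z h ≡ [P]`), ending at
`[R] + z 0 ≡ [R']`. [size M] -/
theorem stub_cylinderPeak : ∀ (d h : ℕ) (R R' : KZ.IntegralRep (d + 1)) (z : ℕ → KZ.FormalRep), z 0 - (KZ.of R' - KZ.of R) ∈ KZ.levelRel → z h ∈ KZ.levelRel → (∀ j < h, ∃ (k : ℕ) (B : Fin k → KZ.IntegralRep (d + 1 + j + 1)) (b : Fin k → KZ.IntegralRep (d + 1 + j)), (∀ i, KZ.of (B i) - KZ.of (b i) ∈ KZ.newtonLeibnizRel) ∧ z (j + 1) - ∑ i, KZ.of (B i) ∈ KZ.levelRel ∧ z j = ∑ i, KZ.of (b i)) → ∃ (M : ℕ) (P : KZ.IntegralRep M) (c c' : KZ.FormalRep), Relation.ReflTransGen KZ.Round (KZ.of P) c ∧ Relation.ReflTransGen KZ.Round (KZ.of P) c' ∧ c - KZ.of R ∈ KZ.levelRel ∧ c' - KZ.of R' ∈ KZ.levelRel := by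
  sorry

/-! ## The stubs read over the notions of the line (definitional, `example`s) -/

example : ∀ ⦃n m : ℕ⦄ (r : IntegralRep n) (r' : IntegralRep m), Equivalent r r' →
    ∃ (d : ℕ) (R R' : IntegralRep (d + 1)), Relation.ReflTransGen Round (of R) (of r) ∧
      Relation.ReflTransGen Round (of R') (of r') ∧
      of R - of R' ∈ AddSubgroup.closure (gens d) := stub_levelling

example : ∀ N : ℕ, ∃ H : AddSubgroup FormalRep, ∀ x, x ∈ H ↔ x ∈ shadows N :=
  stub_shadowSubgroup

example : ∀ (d : ℕ) (B S : IntegralRep (d + 1)) (b : IntegralRep d),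
    of B - of b ∈ newtonLeibnizRel → IsCylOver b S → ZeroShadow (d + 1) 1 (of B - of S) :=
  fun d B S b hNL hS => stub_bandShadow d B S b hNL hS.1 hS.2

example : ∀ (d : ℕ) (g : FormalRep), g ∈ covGens (d + 1) → g ∈ shadows (d + 1) := by
  rintro d g ⟨s, s', Φ, Φ', h₁, h₂, h₃, h₄, h₅, rfl⟩
  exact stub_transportShadow d s s' Φ Φ' h₁ h₂ h₃ h₄ h₅

example : ∀ (d h : ℕ) (R R' : IntegralRep (d + 1)) (z : ℕ → FormalRep),
    z 0 - (of R' - of R) ∈ levelRel → z h ∈ levelRel →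
    (∀ j < h, LRound (d + 1 + j) (z (j + 1)) (z j)) → CUF (of R) (of R') :=
  stub_cylinderPeak

/-- `KZ.Round` is `LRound` with the level bound existentially (definitional sanity check). -/
example (C c : FormalRep) : Round C c ↔ ∃ d, LRound d C c := Iff.rfl

/-! ## Glue (sorry-free) -/

section Glue

/-- Level moves are zero-shadows of height `0` at every level (constant chain). -/
theorem zeroShadow_zero_of_mem_levelRel (N : ℕ) {x : FormalRep} (hx : x ∈ levelRel) :
    ZeroShadow N 0 x :=
  ⟨fun _ => x, by rw [sub_self]; exact levelRel.zero_mem, hx, fun j hj => absurd hj (Nat.not_lt_zero j)⟩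

/-- Hence level moves are zero-shadows. -/
theorem levelRel_subset_shadows (N : ℕ) : (levelRel : Set FormalRep) ⊆ shadows N :=
  fun _ hx => ⟨0, zeroShadow_zero_of_mem_levelRel N hx⟩

/-- **The generators are zero-shadows** (given Stubs 3 and 4): `gens d ⊆ shadows (d + 1)`. -/
theorem gens_subset_shadows
    (hB : ∀ (d : ℕ) (B S : IntegralRep (d + 1)) (b : IntegralRep d),
      of B - of b ∈ newtonLeibnizRel → IsCylOver b S → ZeroShadow (d + 1) 1 (of B - of S))
    (hT : ∀ (d : ℕ) (g : FormalRep), g ∈ covGens (d + 1) → g ∈ shadows (d + 1))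
    (d : ℕ) : gens d ⊆ shadows (d + 1) := by
  rintro g ((hg | hg) | hg)
  · exact levelRel_subset_shadows (d + 1) hg
  · exact hT d g hg
  · obtain ⟨B, S, b, hNL, hS, rfl⟩ := hg
    exact ⟨1, hB d B S b hNL hS⟩

/-- **The congruence, linearised** (given Stubs 2, 3, 4): the subgroup generated by the level-`(d+1)`
generators consists of zero-shadows. -/
theorem closure_gens_subset_shadows
    (hH : ∀ N : ℕ, ∃ H : AddSubgroup FormalRep, ∀ x, x ∈ H ↔ x ∈ shadows N)
    (hB : ∀ (d : ℕ) (B S : IntegralRep (d + 1)) (b : IntegralRep d),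
      of B - of b ∈ newtonLeibnizRel → IsCylOver b S → ZeroShadow (d + 1) 1 (of B - of S))
    (hT : ∀ (d : ℕ) (g : FormalRep), g ∈ covGens (d + 1) → g ∈ shadows (d + 1))
    (d : ℕ) {x : FormalRep} (hx : x ∈ AddSubgroup.closure (gens d)) : -x ∈ shadows (d + 1) := by
  obtain ⟨H, hH⟩ := hH (d + 1)
  have hle : AddSubgroup.closure (gens d) ≤ H :=
    (AddSubgroup.closure_le _).mpr fun g hg => (hH g).mpr (gens_subset_shadows hB hT d hg)
  exact (hH (-x)).mp (H.neg_mem (hle hx))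

/-- Rounds absorb level moves on the left: a round out of `C` is a round out of any `C'`
level-equivalent to `C` (as in `Lines/birth.lean`). -/
theorem round_of_sub_mem_levelRel {C C' c : FormalRep} (h : Round C c) (hC : C' - C ∈ levelRel) :
    Round C' c := by
  obtain ⟨d, k, B, b, hNL, hB, rfl⟩ := h
  refine ⟨d, k, B, b, hNL, ?_, rfl⟩
  have key : C' - ∑ i, of (B i) = (C' - C) + (C - ∑ i, of (B i)) := by abel
  rw [key]
  exact levelRel.add_mem hC hB

/-- `CUF` is symmetric (swap the two descents). -/
theorem CUF.symm {x y : FormalRep} (h : CUF x y) : CUF y x := by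
  obtain ⟨M, R, c, c', hc, hc', hx, hy⟩ := h
  exact ⟨M, R, c', c, hc', hc, hy, hx⟩

/-- DESCENT EXTENSION on the left: continuing the first descent of a common unfolding by a chain of
rounds (read through the level-equivalence at its end) is again a common unfolding. -/
theorem CUF.descend_left {x x₁ y : FormalRep} (h : CUF x y)
    (hx : Relation.ReflTransGen Round x x₁) : CUF x₁ y := by
  obtain ⟨M, R, c, c', hc, hc', hcx, hc'y⟩ := h
  rcases hx.cases_head with rfl | ⟨w, hxw, hwx₁⟩
  · exact ⟨M, R, c, c', hc, hc', hcx, hc'y⟩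
  · have hcw : Round c w := round_of_sub_mem_levelRel hxw hcx
    exact ⟨M, R, x₁, c', (hc.tail hcw).trans hwx₁, hc',
      by rw [sub_self]; exact levelRel.zero_mem, hc'y⟩

/-- Descent extension on both sides. -/
theorem CUF.descend {x x₁ y y₁ : FormalRep} (h : CUF x y)
    (hx : Relation.ReflTransGen Round x x₁) (hy : Relation.ReflTransGen Round y y₁) :
    CUF x₁ y₁ :=
  ((h.descend_left hx).symm.descend_left hy).symm

/-- **Single-peak normal form from the stubs**, concluding `KZ.CommonUnfolding` (the crux's
conclusion over the landed definitions): level; the linearised congruence puts `[R'] − [R]` in the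
shadow subgroup; the cylinder peak gives `CUF [R] [R']`; descend both towers. -/
theorem commonUnfolding_of_equivalent
    (hL : ∀ ⦃n m : ℕ⦄ (r : IntegralRep n) (r' : IntegralRep m), Equivalent r r' →
      ∃ (d : ℕ) (R R' : IntegralRep (d + 1)), Relation.ReflTransGen Round (of R) (of r) ∧
        Relation.ReflTransGen Round (of R') (of r') ∧ of R - of R' ∈ AddSubgroup.closure (gens d))
    (hH : ∀ N : ℕ, ∃ H : AddSubgroup FormalRep, ∀ x, x ∈ H ↔ x ∈ shadows N)
    (hB : ∀ (d : ℕ) (B S : IntegralRep (d + 1)) (b : IntegralRep d),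
      of B - of b ∈ newtonLeibnizRel → IsCylOver b S → ZeroShadow (d + 1) 1 (of B - of S))
    (hT : ∀ (d : ℕ) (g : FormalRep), g ∈ covGens (d + 1) → g ∈ shadows (d + 1))
    (hP : ∀ (d h : ℕ) (R R' : IntegralRep (d + 1)) (z : ℕ → FormalRep),
      z 0 - (of R' - of R) ∈ levelRel → z h ∈ levelRel →
      (∀ j < h, LRound (d + 1 + j) (z (j + 1)) (z j)) → CUF (of R) (of R'))
    {n m : ℕ} (r : IntegralRep n) (r' : IntegralRep m) (h : Equivalent r r') :
    CommonUnfolding r r' := by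
  obtain ⟨d, R, R', hR, hR', hrel⟩ := hL r r' h
  have hneg : -(of R - of R') ∈ shadows (d + 1) := closure_gens_subset_shadows hH hB hT d hrel
  rw [neg_sub] at hneg
  obtain ⟨k, z, hz₀, hzk, hz⟩ := hneg
  have key : CUF (of R) (of R') := hP d k R R' z hz₀ hzk hz
  exact key.descend hR hR'

end Glue

/-! ## The composition -/

/-- **Composition, arrow form** (kernel-checked, sorry-free): the five stub statements imply the
crux statement, written out as `KZ.Equivalent r r' → KZ.CommonUnfolding r r'` (the body of
`PeakNormalForm` once its inlined `let`s are read as `KZ.levelRel`, `KZ.Round` — definitional;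
`PeakNormalForm_of` below performs exactly that conversion). The hypotheses are the stubs read over
the line's notions (`gens`, `shadows`, `ZeroShadow`, `IsCylOver`, `LRound`, `CUF` — all
definitionally the inlined texts, see the `example`s above). -/
theorem PeakNormalForm_of_stubs
    (h₁ : ∀ ⦃n m : ℕ⦄ (r : IntegralRep n) (r' : IntegralRep m), Equivalent r r' →
      ∃ (d : ℕ) (R R' : IntegralRep (d + 1)), Relation.ReflTransGen Round (of R) (of r) ∧
        Relation.ReflTransGen Round (of R') (of r') ∧ of R - of R' ∈ AddSubgroup.closure (gens d))
    (h₂ : ∀ N : ℕ, ∃ H : AddSubgroup FormalRep, ∀ x, x ∈ H ↔ x ∈ shadows N)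
    (h₃ : ∀ (d : ℕ) (B S : IntegralRep (d + 1)) (b : IntegralRep d),
      of B - of b ∈ newtonLeibnizRel →
      S.domain = {z | (Fin.init z : Fin d → ℝ) ∈ b.domain ∧ 0 ≤ z (Fin.last d) ∧ z (Fin.last d) ≤ 1} →
      (∀ z ∈ S.domain, S.integrand z = b.integrand (Fin.init z)) → ZeroShadow (d + 1) 1 (of B - of S))
    (h₄ : ∀ (d : ℕ) (s s' : IntegralRep (d + 1)) (Φ : (Fin (d + 1) → ℝ) → (Fin (d + 1) → ℝ))
      (Φ' : (Fin (d + 1) → ℝ) → (Fin (d + 1) → ℝ) →L[ℝ] (Fin (d + 1) → ℝ)),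
      IsSemialgebraicMapOn ℚ s.domain Φ → (∀ x ∈ s.domain, HasFDerivWithinAt Φ (Φ' x) s.domain x) →
      Set.InjOn Φ s.domain → s'.domain = Φ '' s.domain →
      (∀ x ∈ s.domain, s.integrand x = s'.integrand (Φ x) * |(Φ' x).det|) →
      ∃ h, ZeroShadow (d + 1) h (of s - of s'))
    (h₅ : ∀ (d h : ℕ) (R R' : IntegralRep (d + 1)) (z : ℕ → FormalRep),
      z 0 - (of R' - of R) ∈ levelRel → z h ∈ levelRel →
      (∀ j < h, LRound (d + 1 + j) (z (j + 1)) (z j)) → CUF (of R) (of R')) :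
    ∀ ⦃n m : ℕ⦄ (r : KZ.IntegralRep n) (r' : KZ.IntegralRep m),
      KZ.Equivalent r r' → KZ.CommonUnfolding r r' := by
  intro n m r r' h
  refine commonUnfolding_of_equivalent h₁ h₂ (fun d B S b hNL hS => h₃ d B S b hNL hS.1 hS.2) ?_ h₅
    r r' h
  rintro d g ⟨s, s', Φ, Φ', hΦ, hΦ', hinj, hdom, hint, rfl⟩
  exact h₄ d s s' Φ Φ' hΦ hΦ' hinj hdom hint

/-- **Skeleton theorem** (concludes the crux BY NAME): `PeakNormalForm` from the five registered
stubs through the sorry-free composition `PeakNormalForm_of_stubs`; the only `sorry`s of this file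
sit inside `stub_levelling`, `stub_shadowSubgroup`, `stub_bandShadow`, `stub_transportShadow`,
`stub_cylinderPeak`. -/
theorem PeakNormalForm_of : PeakNormalForm := by
  intro n m r r' h
  exact PeakNormalForm_of_stubs stub_levelling stub_shadowSubgroup stub_bandShadow
    stub_transportShadow stub_cylinderPeak r r' h

end Summit.KontsevichZagierPeriods.KontsevichZagierPeriods.Cruxes.PeakNormalForm.ZeroShadows
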